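import Mathlib
import Summits.CriticalPhenomena.PercolationContinuityZ3.Theorems.PercNearOneGluingAdditiveGluingGoodStepStar
import HarnessLib

/-! # Crux `PercNearOneGluing.AdditiveGluing` (stmt-CriticalPhenomena-4576), line `subuniform-dead-pocket-maximum` — towards `stub_goodStep`, III: the branches

Helper file (siege on `stub_goodStep`, prover-siege-stmt-CriticalPhenomena-4576-stub_goodStep-32);
lands with `--supports stmt-CriticalPhenomena-4576`.

## Content

The termwise inequalities of Kozma–Nitzan's `σ_B`-decomposition at the observer `o`
(arXiv:2401.12397 §3.2, proofs of Theorems 4–5, pp. 13–14), in the penalised linear selection form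
of the line: for a branch `B` (open star of `o` exactly `o–B`) the quantity
`μ(σ_B ∩ {o ↔ A, o ↮ b}) + Σ_{W dead} μ(σ_B ∩ {C(o) = W}) · μ((sel W ↔ b in Wᶜ)ᶜ)` is bounded by
`μ(σ_B ∩ {a₀ ↮ b})`, `a₀` the minimiser over `A` of `τ°(x) = μ(x ↔ b in {o}ᶜ)`:
* null branches (`goodStep_branch_null`);
* the empty star `σ_∅` (`goodStep_branch_empty`: only the pocket `{o}` survives, and
  `μ(σ_∅ ∩ {a₀ ↔ b}) = μ(σ_∅) τ°(a₀)`);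
* stars meeting `A` at `v` (`goodStep_branch_touch`: no dead pocket, and KN's Lemma 5 for an
  arbitrary relay, `stub_lemma5AnyRelay`, compares `a₀` with `o` on `σ_B`);
* dead stars, reduced by pinning to the good-quadruple inequality for the PINNED weighting at the
  DESIGNATED level `1 − μ_pin(a₀ ↔ b)` (`goodStep_branch_of_pinned`).
No new definitions.
-/

namespace Summit.CriticalPhenomena.PercolationContinuityZ3.Theorems

open MeasureTheory Set
open Literature.Probability.LatticeModels (prodBernoulli)
open Literature.Probability.Percolation (BondConfig openConn openConnIn openGraph openCluster
  openGraph_adj DeterminedBy determinedBy_iff PathIn pinW localCylinder)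

noncomputable section
open Classical

variable {n : ℕ}

/-! ### C. The branches of the `σ_B`-decomposition at the observer -/

/-- If no non-loop pair at `o` is open, the open cluster of `o` is `{o}`. [folklore] -/
theorem goodStep_openCluster_self_of_isolated {ω : BondConfig (Fin n)} {o : Fin n}
    (hω : ∀ y : Fin n, y ≠ o → s(o, y) ∉ ω) : openCluster ω o = {o} := by
  ext y
  rw [Set.mem_singleton_iff]
  refine ⟨fun hy => ?_, fun hy => hy ▸ Literature.Probability.Percolation.mem_openCluster_self ω o⟩
  by_contra hyo
  obtain ⟨z, hzo, hz, -⟩ := goodBase_exists_open_pair hy hyo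
  exact hω z hzo hz

/-- **Null branch**: if `μ(σ_B) = 0` the branch inequality is trivial. [folklore] -/
theorem goodStep_branch_null (w : Sym2 (Fin n) → unitInterval) (σ E R : Set (BondConfig (Fin n)))
    (S : Finset (Finset (Fin n))) (P : Finset (Fin n) → Set (BondConfig (Fin n))) (c : Finset (Fin n) → ℝ)
    (h0 : (prodBernoulli w).real σ = 0) :
    (prodBernoulli w).real (σ ∩ E) + ∑ W ∈ S, (prodBernoulli w).real (σ ∩ P W) * c W ≤
      (prodBernoulli w).real (σ ∩ R) := by
  have hz : ∀ X : Set (BondConfig (Fin n)), (prodBernoulli w).real (σ ∩ X) = 0 := fun X =>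
    measureReal_mono_null Set.inter_subset_left h0
  rw [hz E, hz R, Finset.sum_eq_zero fun W _ => by rw [hz (P W), zero_mul]]
  simp

/-- **Empty branch** (`σ_∅`: the star of `o` is closed): the live failure vanishes, the only pocket
is `{o}`, and `μ(σ_∅ ∩ {C(o) = {o}})·(1 − τ°(sel {o})) ≤ μ(σ_∅)(1 − τ°(a₀)) = μ(σ_∅ ∩ {a₀ ↮ b})` for
the `τ°`-minimiser `a₀` (`τ°(x) = μ(x ↔ b in {o}ᶜ)`).
[cite: KozmaNitzan2024, §3.2 pp. 13–14 (proofs of Thms 4, 5)] -/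
theorem goodStep_branch_empty (w : Sym2 (Fin n) → unitInterval) (A : Finset (Fin n)) {o b a₀ : Fin n}
    (hoA : o ∉ A) (ha₀o : a₀ ≠ o) (sel : Finset (Fin n) → Fin n)
    (hmin : (prodBernoulli w).real (openConnIn (({o} : Set (Fin n))ᶜ) a₀ b) ≤
      (prodBernoulli w).real (openConnIn (({o} : Set (Fin n))ᶜ) (sel {o}) b)) :
    (prodBernoulli w).real
        ({ω : BondConfig (Fin n) | ∀ y : Fin n, y ≠ o → s(o, y) ∉ ω} ∩
          ((⋃ a ∈ A, openConn o a) ∩ (openConn o b)ᶜ))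
      + ∑ W ∈ (Finset.univ : Finset (Finset (Fin n))).filter (fun W => o ∈ W ∧ Disjoint W A),
          (prodBernoulli w).real
              ({ω : BondConfig (Fin n) | ∀ y : Fin n, y ≠ o → s(o, y) ∉ ω} ∩
                {ω : BondConfig (Fin n) | openCluster ω o = (W : Set (Fin n))})
            * (prodBernoulli w).real (openConnIn ((W : Set (Fin n))ᶜ) (sel W) b)ᶜ
      ≤ (prodBernoulli w).real
        ({ω : BondConfig (Fin n) | ∀ y : Fin n, y ≠ o → s(o, y) ∉ ω} ∩ (openConn a₀ b)ᶜ) := by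
  -- the live failure vanishes on `σ_∅`
  have hlive : (prodBernoulli w).real
      ({ω : BondConfig (Fin n) | ∀ y : Fin n, y ≠ o → s(o, y) ∉ ω} ∩
        ((⋃ a ∈ A, openConn o a) ∩ (openConn o b)ᶜ)) = 0 := by
    have he : ({ω : BondConfig (Fin n) | ∀ y : Fin n, y ≠ o → s(o, y) ∉ ω} ∩
        ((⋃ a ∈ A, openConn o a) ∩ (openConn o b)ᶜ)) = ∅ :=
      Set.eq_empty_of_forall_notMem fun ω hω => goodBase_iUnion_subset_compl A o hoA hω.2.1 hω.1
    rw [he, measureReal_empty]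
  -- only the pocket `{o}` survives
  have hmem : ({o} : Finset (Fin n)) ∈
      (Finset.univ : Finset (Finset (Fin n))).filter (fun W => o ∈ W ∧ Disjoint W A) :=
    Finset.mem_filter.2 ⟨Finset.mem_univ _, Finset.mem_singleton_self o,
      Finset.disjoint_singleton_left.2 hoA⟩
  have hpen : ∑ W ∈ (Finset.univ : Finset (Finset (Fin n))).filter (fun W => o ∈ W ∧ Disjoint W A),
      (prodBernoulli w).real
          ({ω : BondConfig (Fin n) | ∀ y : Fin n, y ≠ o → s(o, y) ∉ ω} ∩
            {ω : BondConfig (Fin n) | openCluster ω o = (W : Set (Fin n))})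
        * (prodBernoulli w).real (openConnIn ((W : Set (Fin n))ᶜ) (sel W) b)ᶜ =
      (prodBernoulli w).real
          ({ω : BondConfig (Fin n) | ∀ y : Fin n, y ≠ o → s(o, y) ∉ ω} ∩
            {ω : BondConfig (Fin n) | openCluster ω o = ((({o} : Finset (Fin n))) : Set (Fin n))})
        * (prodBernoulli w).real
          (openConnIn (((({o} : Finset (Fin n))) : Set (Fin n)))ᶜ (sel {o}) b)ᶜ := by
    refine Finset.sum_eq_single_of_mem _ hmem fun W hW hWne => ?_
    have he : ({ω : BondConfig (Fin n) | ∀ y : Fin n, y ≠ o → s(o, y) ∉ ω} ∩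
        {ω : BondConfig (Fin n) | openCluster ω o = (W : Set (Fin n))}) = ∅ := by
      refine Set.eq_empty_of_forall_notMem fun ω hω => hWne ?_
      have h1 : openCluster ω o = (W : Set (Fin n)) := hω.2
      rw [goodStep_openCluster_self_of_isolated hω.1, ← Finset.coe_singleton, Finset.coe_inj] at h1
      exact h1.symm
    rw [he, measureReal_empty, zero_mul]
  -- the right-hand side
  have hR : (prodBernoulli w).real
      ({ω : BondConfig (Fin n) | ∀ y : Fin n, y ≠ o → s(o, y) ∉ ω} ∩ (openConn a₀ b)ᶜ) =
      (prodBernoulli w).real {ω : BondConfig (Fin n) | ∀ y : Fin n, y ≠ o → s(o, y) ∉ ω} -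
        (prodBernoulli w).real {ω : BondConfig (Fin n) | ∀ y : Fin n, y ≠ o → s(o, y) ∉ ω} *
          (prodBernoulli w).real (openConnIn (({o} : Set (Fin n))ᶜ) a₀ b) := by
    rw [← goodBase_real_isolated_inter_openConn w o a₀ b ha₀o, ← Set.sdiff_eq,
      eq_sub_iff_add_eq, add_comm]
    exact measureReal_inter_add_sdiff MeasurableSet.of_discrete
  rw [hlive, hpen, hR, zero_add, Finset.coe_singleton,
    probReal_compl_eq_one_sub MeasurableSet.of_discrete]
  have hC : (prodBernoulli w).real
      ({ω : BondConfig (Fin n) | ∀ y : Fin n, y ≠ o → s(o, y) ∉ ω} ∩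
        {ω : BondConfig (Fin n) | openCluster ω o = ({o} : Set (Fin n))}) ≤
      (prodBernoulli w).real {ω : BondConfig (Fin n) | ∀ y : Fin n, y ≠ o → s(o, y) ∉ ω} :=
    measureReal_mono Set.inter_subset_left
  have h1 : (prodBernoulli w).real (openConnIn (({o} : Set (Fin n)))ᶜ (sel {o}) b) ≤ 1 :=
    measureReal_le_one
  have hCnn : 0 ≤ (prodBernoulli w).real
      ({ω : BondConfig (Fin n) | ∀ y : Fin n, y ≠ o → s(o, y) ∉ ω} ∩
        {ω : BondConfig (Fin n) | openCluster ω o = ({o} : Set (Fin n))}) := measureReal_nonneg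
  nlinarith [hC, h1, hCnn, hmin]

/-- **`A`-touching branch** (`v ∈ B ∩ A`): on `σ_B` the observer reaches the relay `v`, so no
pocket is dead, the live failure is at most `μ(σ_B ∩ {o ↮ b})`, and KN's Lemma 5 (any relay,
`stub_lemma5AnyRelay`) gives `μ(σ_B ∩ {o ↮ b}) ≤ μ(σ_B ∩ {a₀ ↮ b})` for the `τ°`-minimiser `a₀`.
[cite: KozmaNitzan2024, §3.2 p. 14 (proof of Thm 5, (15))] -/
theorem goodStep_branch_touch (w : Sym2 (Fin n) → unitInterval) (A : Finset (Fin n)) {o b a₀ v : Fin n}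
    (B : Finset (Fin n)) (hbo : b ≠ o) (ha₀o : a₀ ≠ o) (hoB : o ∉ B) (hvB : v ∈ B) (hvA : v ∈ A)
    (sel : Finset (Fin n) → Fin n)
    (hmin : (prodBernoulli w).real (openConnIn (({o} : Set (Fin n))ᶜ) a₀ b) ≤
      (prodBernoulli w).real (openConnIn (({o} : Set (Fin n))ᶜ) v b)) :
    (prodBernoulli w).real
        ({ω : BondConfig (Fin n) | ∀ y : Fin n, y ≠ o → (s(o, y) ∈ ω ↔ y ∈ B)} ∩
          ((⋃ a ∈ A, openConn o a) ∩ (openConn o b)ᶜ))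
      + ∑ W ∈ (Finset.univ : Finset (Finset (Fin n))).filter (fun W => o ∈ W ∧ Disjoint W A),
          (prodBernoulli w).real
              ({ω : BondConfig (Fin n) | ∀ y : Fin n, y ≠ o → (s(o, y) ∈ ω ↔ y ∈ B)} ∩
                {ω : BondConfig (Fin n) | openCluster ω o = (W : Set (Fin n))})
            * (prodBernoulli w).real (openConnIn ((W : Set (Fin n))ᶜ) (sel W) b)ᶜ
      ≤ (prodBernoulli w).real
        ({ω : BondConfig (Fin n) | ∀ y : Fin n, y ≠ o → (s(o, y) ∈ ω ↔ y ∈ B)} ∩ (openConn a₀ b)ᶜ) := by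
  have hvo : v ≠ o := fun h => hoB (h ▸ hvB)
  -- no dead pocket
  have hpen : ∑ W ∈ (Finset.univ : Finset (Finset (Fin n))).filter (fun W => o ∈ W ∧ Disjoint W A),
      (prodBernoulli w).real
          ({ω : BondConfig (Fin n) | ∀ y : Fin n, y ≠ o → (s(o, y) ∈ ω ↔ y ∈ B)} ∩
            {ω : BondConfig (Fin n) | openCluster ω o = (W : Set (Fin n))})
        * (prodBernoulli w).real (openConnIn ((W : Set (Fin n))ᶜ) (sel W) b)ᶜ = 0 := by
    refine Finset.sum_eq_zero fun W hW => ?_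
    have hWA := (Finset.mem_filter.1 hW).2.2
    have he : ({ω : BondConfig (Fin n) | ∀ y : Fin n, y ≠ o → (s(o, y) ∈ ω ↔ y ∈ B)} ∩
        {ω : BondConfig (Fin n) | openCluster ω o = (W : Set (Fin n))}) = ∅ := by
      refine Set.eq_empty_of_forall_notMem fun ω hω => ?_
      have hv : s(o, v) ∈ ω := (hω.1 v hvo).2 hvB
      have hvC : v ∈ openCluster ω o := ((openGraph_adj ω o v).2 ⟨hv, hvo.symm⟩).reachable
      have h1 : openCluster ω o = (W : Set (Fin n)) := hω.2
      rw [h1] at hvC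
      exact Finset.disjoint_left.1 hWA (Finset.mem_coe.1 hvC) hvA
    rw [he, measureReal_empty, zero_mul]
  -- live failure inside `{o ↮ b}`
  have hlive : (prodBernoulli w).real
      ({ω : BondConfig (Fin n) | ∀ y : Fin n, y ≠ o → (s(o, y) ∈ ω ↔ y ∈ B)} ∩
        ((⋃ a ∈ A, openConn o a) ∩ (openConn o b)ᶜ)) ≤
      (prodBernoulli w).real
        ({ω : BondConfig (Fin n) | ∀ y : Fin n, y ≠ o → (s(o, y) ∈ ω ↔ y ∈ B)} ∩ (openConn o b)ᶜ) :=
    measureReal_mono fun ω hω => ⟨hω.1, hω.2.2⟩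
  -- complements inside `σ_B`
  have hc : ∀ X : Set (BondConfig (Fin n)), (prodBernoulli w).real
      ({ω : BondConfig (Fin n) | ∀ y : Fin n, y ≠ o → (s(o, y) ∈ ω ↔ y ∈ B)} ∩ Xᶜ) =
      (prodBernoulli w).real {ω : BondConfig (Fin n) | ∀ y : Fin n, y ≠ o → (s(o, y) ∈ ω ↔ y ∈ B)} -
        (prodBernoulli w).real
          ({ω : BondConfig (Fin n) | ∀ y : Fin n, y ≠ o → (s(o, y) ∈ ω ↔ y ∈ B)} ∩ X) := by
    intro X
    rw [← Set.sdiff_eq, eq_sub_iff_add_eq, add_comm]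
    exact measureReal_inter_add_sdiff MeasurableSet.of_discrete
  have h5 := stub_lemma5AnyRelay n w o b a₀ v B hbo ha₀o hoB hvB hmin
  rw [hpen, add_zero, hc]
  have hc' := hc (openConn o b)
  linarith [hlive, h5, hc']

/-- **Dead branch, pinned form**: for `B ∌ o`, the branch inequality on `σ_B` follows from the
good-quadruple inequality for the PINNED weighting (star of `o` pinned to the pattern `o–B`) at
the designated level `1 − μ_pin(a₀ ↔ b)`, by the factorisation `μ(σ_B ∩ X) = μ(σ_B) μ_pin(X)`
and the off-star nature of the avoidance events. [cite: KozmaNitzan2024, §3.2 p. 14 (proof of Thm 5)] -/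
theorem goodStep_branch_of_pinned (w : Sym2 (Fin n) → unitInterval) (A : Finset (Fin n))
    {o b a₀ : Fin n} (B : Finset (Fin n)) (sel : Finset (Fin n) → Fin n)
    {F : Finset (Sym2 (Fin n))} (hF : ∀ e, e ∈ F ↔ o ∈ e ∧ ¬ e.IsDiag)
    {ξ : Set (Sym2 (Fin n))} (hξ : ∀ y : Fin n, s(o, y) ∈ ξ ↔ y ∈ B)
    (hD : (prodBernoulli (pinW w ↑F ξ)).real ((⋃ a ∈ A, openConn o a) ∩ (openConn o b)ᶜ)
      + ∑ W ∈ (Finset.univ : Finset (Finset (Fin n))).filter (fun W => o ∈ W ∧ Disjoint W A),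
          (prodBernoulli (pinW w ↑F ξ)).real {ω : BondConfig (Fin n) | openCluster ω o = (W : Set (Fin n))}
            * (prodBernoulli (pinW w ↑F ξ)).real (openConnIn ((W : Set (Fin n))ᶜ) (sel W) b)ᶜ
      ≤ 1 - (prodBernoulli (pinW w ↑F ξ)).real (openConn a₀ b)) :
    (prodBernoulli w).real
        ({ω : BondConfig (Fin n) | ∀ y : Fin n, y ≠ o → (s(o, y) ∈ ω ↔ y ∈ B)} ∩
          ((⋃ a ∈ A, openConn o a) ∩ (openConn o b)ᶜ))
      + ∑ W ∈ (Finset.univ : Finset (Finset (Fin n))).filter (fun W => o ∈ W ∧ Disjoint W A),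
          (prodBernoulli w).real
              ({ω : BondConfig (Fin n) | ∀ y : Fin n, y ≠ o → (s(o, y) ∈ ω ↔ y ∈ B)} ∩
                {ω : BondConfig (Fin n) | openCluster ω o = (W : Set (Fin n))})
            * (prodBernoulli w).real (openConnIn ((W : Set (Fin n))ᶜ) (sel W) b)ᶜ
      ≤ (prodBernoulli w).real
        ({ω : BondConfig (Fin n) | ∀ y : Fin n, y ≠ o → (s(o, y) ∈ ω ↔ y ∈ B)} ∩ (openConn a₀ b)ᶜ) := by
  -- the avoidance factors are off-star: `μ_w = μ_pin` on them
  have hav : ∀ W ∈ (Finset.univ : Finset (Finset (Fin n))).filter (fun W => o ∈ W ∧ Disjoint W A),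
      (prodBernoulli w).real
          ({ω : BondConfig (Fin n) | ∀ y : Fin n, y ≠ o → (s(o, y) ∈ ω ↔ y ∈ B)} ∩
            {ω : BondConfig (Fin n) | openCluster ω o = (W : Set (Fin n))})
        * (prodBernoulli w).real (openConnIn ((W : Set (Fin n))ᶜ) (sel W) b)ᶜ =
      (prodBernoulli w).real {ω : BondConfig (Fin n) | ∀ y : Fin n, y ≠ o → (s(o, y) ∈ ω ↔ y ∈ B)} *
        ((prodBernoulli (pinW w ↑F ξ)).real {ω : BondConfig (Fin n) | openCluster ω o = (W : Set (Fin n))}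
          * (prodBernoulli (pinW w ↑F ξ)).real (openConnIn ((W : Set (Fin n))ᶜ) (sel W) b)ᶜ) := by
    intro W hW
    have hoW := (Finset.mem_filter.1 hW).2.1
    rw [goodStep_sigma_factor w hF hξ, mul_assoc,
      Literature.Probability.LatticeModels.prodBernoulli_real_eq_of_determinedBy w (pinW w ↑F ξ)
        (fun e he => (goodStep_pin_offstar w hF ξ e he).symm)
        (goodStep_determinedBy_compl (goodStep_determinedBy_openConnIn_compl W hoW (sel W) b))
        MeasurableSet.of_discrete]
  rw [Finset.sum_congr rfl hav, ← Finset.mul_sum, goodStep_sigma_factor w hF hξ,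
    goodStep_sigma_factor w hF hξ, ← mul_add, probReal_compl_eq_one_sub MeasurableSet.of_discrete]
  exact mul_le_mul_of_nonneg_left hD measureReal_nonneg

/-! ### Registered waypoint (siege k32) -/

/-- Registered sub-goal `stub_goodStepBranchTouch_k32` of stmt-CriticalPhenomena-4576 (siege k32 on
`stub_goodStep`): **the `A`-touching branch** — for `v ∈ B ∩ A` the branch term of `σ_B` (live
failure + dead-pocket penalty) is at most `μ(σ_B ∩ {a₀ ↮ b})` whenever `τ°(a₀) ≤ τ°(v)` (KN Lemma 5,
any relay). [cite: KozmaNitzan2024, §3.2 p. 14 (proof of Thm 5, (15))] -/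
theorem stub_goodStepBranchTouch_k32 :
    ∀ (n : ℕ) (w : Sym2 (Fin n) → unitInterval) (A B : Finset (Fin n)) (o b a₀ v : Fin n)
      (sel : Finset (Fin n) → Fin n),
      b ≠ o → a₀ ≠ o → o ∉ B → v ∈ B → v ∈ A →
      (prodBernoulli w).real (openConnIn (({o} : Set (Fin n))ᶜ) a₀ b) ≤
        (prodBernoulli w).real (openConnIn (({o} : Set (Fin n))ᶜ) v b) →
      (prodBernoulli w).real
          ({ω : BondConfig (Fin n) | ∀ y : Fin n, y ≠ o → (s(o, y) ∈ ω ↔ y ∈ B)} ∩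
            ((⋃ a ∈ A, openConn o a) ∩ (openConn o b)ᶜ))
        + ∑ W ∈ (Finset.univ : Finset (Finset (Fin n))).filter (fun W => o ∈ W ∧ Disjoint W A),
            (prodBernoulli w).real
                ({ω : BondConfig (Fin n) | ∀ y : Fin n, y ≠ o → (s(o, y) ∈ ω ↔ y ∈ B)} ∩
                  {ω : BondConfig (Fin n) | openCluster ω o = (W : Set (Fin n))})
              * (prodBernoulli w).real (openConnIn ((W : Set (Fin n))ᶜ) (sel W) b)ᶜ
        ≤ (prodBernoulli w).real
          ({ω : BondConfig (Fin n) | ∀ y : Fin n, y ≠ o → (s(o, y) ∈ ω ↔ y ∈ B)} ∩ (openConn a₀ b)ᶜ) := by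
  intro n w A B o b a₀ v sel hbo ha₀o hoB hvB hvA hmin
  exact goodStep_branch_touch w A B hbo ha₀o hoB hvB hvA sel hmin

end

end Summit.CriticalPhenomena.PercolationContinuityZ3.Theorems
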